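import Literature.MathematicalPhysics.QuantumFieldTheory.Balaban1983to89.B7Prop4GeneralLevelsRec

/-!
# `Balaban1983to89.B7Eq123GeneralRec` — [Balaban1985Averaging] PROPOSITION 3's (123) AND PROPOSITION 4's (130)∕(131) AT A GENERAL REGULAR BACKGROUND, k-UNIFORM, UNCONDITIONAL,
# FOR THE RECORD's AVERAGING STRUCTURE ([Balaban1987RG1] (0.4)) — the record twin of the engine's `B7Eq123General`

statement-level skeleton of published theorems with citation tags; proofs where landed; nothing here is a claim about the Yang–Mills mass gap

CITATION HEADER (lean-in-tree rule).  Cell `pub-ymgap`, seat `pub-ymgap-dag-n05-e` g36 (N05-REC LEAD PEN); item R1 ([3] layer): the record twin of `B7Eq123General` (pub-balaban t4 NE7c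
leaf-11 gen 2, row S55; p06 gen 2 `prop4_general`).  `--kind proof --supports stmt-QuantumFields-20541` (K0⁷; count-neutral; no definition).  Sources READ: [3] = [Balaban1985Averaging]
pp. 36–38 (122)–(133), p. 42 (161), p. 25 (Prop. 1 loops) (`paper:balaban1985-cmp98-averaging`); [I] = [Balaban1987RG1] (0.4) p. 253.  REUSED BY NAME: `B7Prop3GeneralAnalyticRec`
(`prop3Z_general_analyticAt_of_le_c3`, `norm_mlog_dbavgCovZ_le`, `logDomainCovZ` — dag-n05-e g35), `B7Prop4GeneralLevelsRec.prop4_generalZ_of_prop3` (g36), `B7Prop3GeneralLinearPdevRec`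
(`WZ_regular_of_plaquettes`, `omegaC_le`), `B7Prop3GeneralTildRec` (`linQcovZ_add∕smul`), `B7Prop3GeneralLinearRec.QcovZ_zero`, engine `B7Prop3Flat.c3`, `B7Prop4Flat.expUnit_mlog`.

WHAT IS PROVED (sorry-free).  §1 [folklore] the second-order Cauchy estimate at the centre of a disc (`private`, copied from the engine file where it is `private`); §2 `blockLoopsZ_of_pdev` — small
plaquette deviation ⇒ the (0.4) loops at every `L`-bond are within `d(d+2)L²β∕4 ≤ 1∕64` of `1` (`L = 2s+1`, `β ≤ 1∕(1024(d+1)(d+4)L²)`); §3 ★★`norm_CcovZ_le` — (123) «|C(V₀, A, c)| ≦ C₁L²|A|²»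
FOR THE RECORD: `‖C(V₀, A, c)‖ ≤ (8∕c₃²)·a²`, print's route (analytic along the ray, vanishes at `0`, `|·| ≤ 4` on the disc `|t| ≤ c₃∕a`, Cauchy at `t = 1`); `norm_CcovZ_le_explicit`
(`C₁ = 131072(d+1)²`), `norm_CcovZ_le_of_pdev`; §4 `h3remZ_of_pdev` (the binder of `prop4_generalZ_of_prop3` SUPPLIED), `linQcovZ_sub_of_loops`; §5 ★★★`prop4_generalZ` — PROPOSITION 4
(130)∕(131) FOR THE RECORD, k-UNIFORM, UNCONDITIONAL: for `U₀` in an averaging-closed `G` with `pdev U₀ < α₀L^{−2k}`, `C₀α₀ ≤ 1∕3`, `4α₀ ≤ c₂′`, `sup‖B‖ ≤ b` with `e^{4cZα₀}(1 + 2C₁KZ²·L^kb) ≤ 2`,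
`KZ·L^kb ≤ c₃`, odd `L ≥ 3`, `d ≥ 1`: at every `j ≤ k`, `‖L^jηQ_j(U₀)B‖ ≤ (1+2gZ)e^{4cZα₀}L^jb`, `‖Q_j(U₀,ηB) − L^jηQ_j(U₀)B‖ ≤ (1+2gZ)·2C₁KZ²·e^{4cZα₀}(L^jb)²`, `‖Q_j(U₀,ηB)‖ ≤ KZ·L^jb`;
§6 `level_dataZ`, ★`dbavgCovIterZ_eq_expCfg_logCovIterZ` («U̿₁ʲ = e^{Q_j(U₀,ηB)}» bondwise) and `norm_mlog_dbavgCovIterZ_le` ((161) for the record, with `KZ` for print's `2`).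
HONEST SCOPE.  The record's Prop. 3 (123) and Prop. 4 (130)∕(131) as kernel theorems with explicit constants in `d, L` (uniform in `k`); the carried gauge letter rides inside
`L^jηQ_j(U₀)B = linCovIterZ` (its decomposition `Q̂`-iterate + covariant pure gauge is `B7Prop4GaugeInductionRec`); nothing of [3]∕[6]∕[I] asserted beyond what is proved; `HThm4Rec`
UNDISCHARGED; N05 discharged of record untouched; N07 not claimable; counts unmoved (typed 28∕28 · discharged 8∕28); one finite 𝕋⁴ programme at fixed ε — nothing continuum ∕ ℝ⁴ ∕ OS ∕ mass
gap ∕ Clay.  No `def`, no `instance`, no `notation`, no `sorry`.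
-/

set_option autoImplicit false

noncomputable section

open scoped BigOperators
open NormedSpace Metric Set Finset

namespace Literature.MathematicalPhysics.QuantumFieldTheory.Balaban1983to89.B7Eq123GeneralRec

open B7Prop1Explicit hiding Site
open B7Prop1Explicit renaming Site → SiteZ
open B7Prop2Explicit (pdev le_pdev pdev_nonneg rescale c2')
open B7Prop3Flat (expCfg c3 c3_pos)
open MatrixLog
open BlockAveragingZd (IdxZ WZ avgIterZ)
open B8Lemma1NonAbelianRecLoops (omegaC)
open B7SectCDGaugeAveragesRec (dbavgCovZ dbavgCovIterZ)
open B7SectEFLinearisationRec (QcovZ linQcovZ CcovZ logCovIterZ linCovIterZ logCovIterZ_succ)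
open B7Eq92ConcreteRec (dbavgCovIterZ_succ_apply)
open B7Prop2Rec (AvgClosedZ C0Z)
open B7Prop3GeneralLinearRec (QcovZ_zero)
open B7Prop3GeneralTildRec (linQcovZ_add linQcovZ_smul)
open B7Prop3GeneralAnalyticRec (prop3Z_general_analyticAt_of_le_c3 norm_mlog_dbavgCovZ_le logDomainCovZ)
open B7Prop3GeneralLinearPdevRec (WZ_regular_of_plaquettes omegaC_le)
open B7Prop4GeneralLevelsRec (cZ gZ KZ cZ_nonneg gZ_nonneg level_regularityZ prop4_generalZ_of_prop3)

/-! ## §1 [folklore] The second-order Cauchy estimate at the centre of a disc -/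

section Cauchy

variable {F : Type*} [NormedAddCommGroup F] [NormedSpace ℂ F] [CompleteSpace F]

/-- **Second-order Cauchy estimate at the centre of a disc**: `g` complex-differentiable on the closed disc `|t| ≤ R`, `g 0 = 0`, `‖g‖ ≤ M` on the circle `|t| = R` ⟹ `‖g t − t·g′(0)‖ ≤
(2M∕R²)·|t|²` for `|t| ≤ R` (`private` generic helper, verbatim from the engine's `B7Eq123General` where it is private). [folklore] -/
private theorem norm_sub_smul_deriv_le_of_sphere {g : ℂ → F} {R M : ℝ} (hR : 0 < R)
    (hg : DifferentiableOn ℂ g (closedBall 0 R)) (hM : ∀ z ∈ sphere (0 : ℂ) R, ‖g z‖ ≤ M) (h0 : g 0 = 0)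
    {t : ℂ} (ht : ‖t‖ ≤ R) : ‖g t - t • deriv g 0‖ ≤ 2 * M / R ^ 2 * ‖t‖ ^ 2 := by
  have hcl : closure (ball (0 : ℂ) R) = closedBall 0 R := closure_ball 0 hR.ne'
  have hfr : frontier (ball (0 : ℂ) R) = sphere 0 R := frontier_ball 0 hR.ne'
  have hnhds : closedBall (0 : ℂ) R ∈ nhds (0 : ℂ) := closedBall_mem_nhds 0 hR
  set φ : ℂ → F := dslope g 0 with hφ
  set ψ : ℂ → F := dslope φ 0 with hψ
  have hφd : DifferentiableOn ℂ φ (closedBall 0 R) := (Complex.differentiableOn_dslope hnhds).2 hg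
  have hψd : DifferentiableOn ℂ ψ (closedBall 0 R) := (Complex.differentiableOn_dslope hnhds).2 hφd
  have hφ_eq : ∀ s : ℂ, s • φ s = g s := fun s => by
    have := sub_smul_dslope g 0 s
    rwa [sub_zero, h0, sub_zero] at this
  have hψ_eq : ∀ s : ℂ, s • ψ s = φ s - deriv g 0 := fun s => by
    have := sub_smul_dslope φ 0 s
    rwa [sub_zero, hφ, dslope_same] at this
  have hgc : DiffContOnCl ℂ g (ball 0 R) := DifferentiableOn.diffContOnCl (by rw [hcl]; exact hg)
  have hψc : DiffContOnCl ℂ ψ (ball 0 R) := DifferentiableOn.diffContOnCl (by rw [hcl]; exact hψd)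
  have hg' : ‖deriv g 0‖ ≤ M / R := Complex.norm_deriv_le_of_forall_mem_sphere_norm_le hR hgc hM
  have hψS : ∀ z ∈ sphere (0 : ℂ) R, ‖ψ z‖ ≤ 2 * M / R ^ 2 := by
    intro z hz
    have hzR : ‖z‖ = R := mem_sphere_zero_iff_norm.1 hz
    have h2 : R * ‖ψ z‖ ≤ M / R + M / R := by
      have := congrArg (‖·‖) (hψ_eq z)
      simp only [norm_smul, hzR] at this
      rw [this]
      refine (norm_sub_le _ _).trans (add_le_add ?_ hg')
      have h1 : R * ‖φ z‖ ≤ M := by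
        have := congrArg (‖·‖) (hφ_eq z)
        simp only [norm_smul, hzR] at this
        rw [this]; exact hM z hz
      rw [le_div_iff₀ hR]; linarith
    rw [le_div_iff₀ (by positivity)]
    have : R * (R * ‖ψ z‖) ≤ R * (M / R + M / R) := mul_le_mul_of_nonneg_left h2 hR.le
    have hRR : R * (M / R + M / R) = 2 * M := by field_simp; ring
    nlinarith
  have hψt : ‖ψ t‖ ≤ 2 * M / R ^ 2 :=
    Complex.norm_le_of_forall_mem_frontier_norm_le isBounded_ball hψc (by rw [hfr]; exact hψS)
      (by rw [hcl]; exact mem_closedBall_zero_iff.2 ht)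
  have hrem : g t - t • deriv g 0 = t • (t • ψ t) := by
    rw [hψ_eq t, smul_sub, hφ_eq t]
  rw [hrem, norm_smul, norm_smul]
  have ht0 : 0 ≤ ‖t‖ := norm_nonneg t
  calc ‖t‖ * (‖t‖ * ‖ψ t‖) ≤ ‖t‖ * (‖t‖ * (2 * M / R ^ 2)) := by gcongr
    _ = 2 * M / R ^ 2 * ‖t‖ ^ 2 := by ring

end Cauchy

variable {d : ℕ}
variable {𝔸 : Type*} [NormedRing 𝔸] [NormedAlgebra ℂ 𝔸] [CompleteSpace 𝔸] [NormOneClass 𝔸]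
variable (L : ℕ)

/-! ## §2 Small plaquette deviation ⇒ regular (0.4) loops at every `L`-bond -/

omit [NormedAlgebra ℂ 𝔸] [CompleteSpace 𝔸] in
/-- **p. 25 in plaquette currency, for the record's loops**: `pdev V₀ < β` and `β ≤ 1∕(1024(d+1)(d+4)L²)`, `L = 2s+1`, give `‖V₀(Γ^σ ∪ [x,x′] ∪ (−Γ^{σ′}) ∪ (−c)) − 1‖ ≤ d(d+2)L²β∕4 ≤
1∕64` at every `L`-bond and every loop index (dag-n05-d's tree-gauge count `norm_WZ_sub_one_le` via `WZ_regular_of_plaquettes`). [cite: Balaban1985Averaging, p.25 (displays before (47)); Balaban1987RG1, (0.4) p.253] -/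
theorem blockLoopsZ_of_pdev {s : ℕ} (hLs : L = 2 * s + 1) {V₀ : SiteZ d → Fin d → 𝔸ˣ}
    (hV₀ : ∀ x κ, V₀ x κ ∈ U1 𝔸) {β : ℝ} (hβ0 : 0 ≤ β) (hβ : pdev V₀ < β)
    (hβmax : β ≤ 1 / (1024 * ((d : ℝ) + 1) * ((d : ℝ) + 4) * (L : ℝ) ^ 2)) (q : SiteZ d) (κ : Fin d) :
    (∀ i : IdxZ d L, ‖((WZ L V₀ q κ i : 𝔸ˣ) : 𝔸) - 1‖ ≤ (d : ℝ) * (d + 2) * (L : ℝ) ^ 2 / 4 * β) ∧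
    (d : ℝ) * (d + 2) * (L : ℝ) ^ 2 / 4 * β ≤ 1 / 64 := by
  have hL1 : 1 ≤ L := by omega
  have hL0 : (0 : ℝ) < L := by exact_mod_cast hL1
  have hX : (0 : ℝ) < 1024 * ((d : ℝ) + 1) * ((d : ℝ) + 4) * (L : ℝ) ^ 2 := by positivity
  have hXβ : 1024 * ((d : ℝ) + 1) * ((d : ℝ) + 4) * (L : ℝ) ^ 2 * β ≤ 1 := by
    have := mul_le_mul_of_nonneg_left hβmax hX.le
    rwa [one_div, mul_inv_cancel₀ hX.ne'] at this
  have h44 : ∀ (x : SiteZ d) (κ' μ : Fin d), κ' ≠ μ → ‖((hol V₀ x (plaqWord κ' μ) : 𝔸ˣ) : 𝔸) - 1‖ ≤ β :=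
    fun x κ' μ _ => (le_pdev hV₀ x κ' μ).trans hβ.le
  have hω := (omegaC_le (d := d) L hβ0 hLs).1
  have hd0 : (0 : ℝ) ≤ d := by positivity
  refine ⟨fun i => (WZ_regular_of_plaquettes L hV₀ hβ0 h44 hLs q κ i).trans hω, ?_⟩
  have h1 : (d : ℝ) * (d + 2) ≤ 16 * (((d : ℝ) + 1) * ((d : ℝ) + 4)) := by nlinarith
  have hL2 : 0 ≤ (L : ℝ) ^ 2 * β := by positivity
  nlinarith [mul_le_mul_of_nonneg_right h1 hL2]

/-! ## §3 (123) at a general regular background for the record: the second-order remainder by the Cauchy estimate along the ray -/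

/-- print's threshold in the `θ`-currency: `a ≤ c₃(d, L) = 1∕(128(d+1)L)` gives `(2d+2)L·a ≤ 1∕64` (private helper, as in the engine). [cite: Balaban1985Averaging, Proposition 3 p.36] -/
private theorem theta_le_of_le_c3 {L : ℕ} (hL : 1 ≤ L) {a : ℝ} (hac : a ≤ c3 d L) :
    ((2 * (d * L) + L + L : ℕ) : ℝ) * a ≤ 1 / 64 := by
  have hL1 : (1 : ℝ) ≤ L := by exact_mod_cast hL
  have hcast : ((2 * (d * L) + L + L : ℕ) : ℝ) = 2 * ((d : ℝ) + 1) * L := by push_cast; ring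
  rw [hcast]
  have hpos : (0 : ℝ) < 128 * ((d : ℝ) + 1) * L := by positivity
  have h1 : a * (128 * ((d : ℝ) + 1) * L) ≤ 1 := by
    have := mul_le_mul_of_nonneg_right hac hpos.le
    rwa [c3, one_div, inv_mul_cancel₀ hpos.ne'] at this
  nlinarith

/-- ★★ **[3] PROPOSITION 3, (123) AT A GENERAL BACKGROUND FOR THE RECORD's AVERAGING STRUCTURE** — «C(V₀, A, c) is an analytic function of A whose Taylor's expansion begins with a
second-order polynomial, and |C(V₀, A, c)| ≦ C₁L²|A|²»: for `V₀` unit-bounded with `α`-regular (0.4) loops at the `L`-bond `c = (q, κ)` (`α ≤ 1∕64`) and `sup_b|A_b| ≤ a ≤ c₃(d, L)`: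
`‖C(V₀, A, c)‖ ≤ (8∕c₃(d,L)²)·a²` — print's route verbatim for the record (ray analytic by `prop3Z_general_analyticAt_of_le_c3`, bounded by `4` by `norm_mlog_dbavgCovZ_le`, vanishing at `0`,
derivative at `0` = «L(Q(V₀)A)_c» by definition, §1 at `t = 1`). [cite: Balaban1985Averaging, Proposition 3 (123) p.36; Balaban1987RG1, (0.4) p.253] -/
theorem norm_CcovZ_le {L : ℕ} (hL : 1 ≤ L) {V₀ : SiteZ d → Fin d → 𝔸ˣ} (hV₀ : ∀ x κ, V₀ x κ ∈ U1 𝔸)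
    (A : SiteZ d → Fin d → 𝔸) {a α : ℝ} (ha : 0 ≤ a) (hA : ∀ x κ, ‖A x κ‖ ≤ a) (hac : a ≤ c3 d L)
    (q : SiteZ d) (κ : Fin d) (hα1 : α ≤ 1 / 64)
    (hreg : ∀ i : IdxZ d L, ‖((WZ L V₀ q κ i : 𝔸ˣ) : 𝔸) - 1‖ ≤ α) :
    ‖CcovZ L V₀ A q κ‖ ≤ 8 / (c3 d L) ^ 2 * a ^ 2 := by
  rcases ha.eq_or_lt with h0 | hpos
  · -- the degenerate field `A = 0`
    have hA0 : A = 0 := by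
      funext x κ'
      have := hA x κ'
      rw [← h0] at this
      exact norm_le_zero_iff.1 this
    subst hA0
    have hlin : linQcovZ L V₀ (0 : SiteZ d → Fin d → 𝔸) q κ = 0 := by
      simp only [linQcovZ, smul_zero, QcovZ_zero, deriv_const]
    rw [CcovZ, QcovZ_zero, hlin, sub_zero, norm_zero]
    positivity
  set g : ℂ → 𝔸 := fun t : ℂ => QcovZ L V₀ (t • A) q κ with hg
  set R : ℝ := c3 d L / a with hR
  have hR1 : 1 ≤ R := by rw [hR, le_div_iff₀ hpos]; linarith
  have hR0 : 0 < R := by linarith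
  have hdisc : ∀ t : ℂ, ‖t‖ ≤ R → ‖t‖ * a ≤ c3 d L := fun t ht => by
    rw [hR, le_div_iff₀ hpos] at ht; exact ht
  have htA : ∀ t : ℂ, ∀ x κ', ‖(t • A) x κ'‖ ≤ ‖t‖ * a := fun t x κ' => by
    rw [Pi.smul_apply, Pi.smul_apply, norm_smul]; exact mul_le_mul_of_nonneg_left (hA x κ') (norm_nonneg _)
  have hDiff : DifferentiableOn ℂ g (closedBall 0 R) := fun t ht => by
    have han : AnalyticAt ℂ g t :=
      prop3Z_general_analyticAt_of_le_c3 (fun t : ℂ => t • A)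
        (fun x κ' => by simp only [Pi.smul_apply]; exact analyticAt_id.smul analyticAt_const)
        hL hV₀ (by positivity) (htA t) (hdisc t (mem_closedBall_zero_iff.1 ht)) q κ hα1 hreg
    exact han.differentiableAt.differentiableWithinAt
  have hM : ∀ t ∈ sphere (0 : ℂ) R, ‖g t‖ ≤ 4 := fun t ht =>
    norm_mlog_dbavgCovZ_le hL hV₀ (t • A) (a := ‖t‖ * a) (by positivity) (htA t) le_rfl (by positivity)
      (theta_le_of_le_c3 hL (hdisc t (mem_sphere_zero_iff_norm.1 ht).le)) q κ hα1 hreg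
  have h0 : g 0 = 0 := by simp only [hg, zero_smul]; exact QcovZ_zero L V₀ q κ
  have h := norm_sub_smul_deriv_le_of_sphere hR0 hDiff hM h0 (t := 1) (by rw [norm_one]; exact hR1)
  rw [norm_one, one_pow, mul_one, one_smul] at h
  have hg1 : g 1 = QcovZ L V₀ A q κ := by simp only [hg, one_smul]
  have hgd : deriv g 0 = linQcovZ L V₀ A q κ := rfl
  rw [hg1, hgd] at h
  rw [CcovZ]
  refine h.trans (le_of_eq ?_)
  have ha' : a ≠ 0 := hpos.ne'
  have hc : c3 d L ≠ 0 := (c3_pos d hL).ne'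
  rw [hR, div_pow]
  field_simp
  ring

/-- print's constant made explicit: `8∕c₃(d,L)² = 131072·(d+1)²·L²` («C₁L²», `C₁ = 131072(d+1)²`). [cite: Balaban1985Averaging, Proposition 3 (123) p.36] -/
theorem norm_CcovZ_le_explicit {L : ℕ} (hL : 1 ≤ L) {V₀ : SiteZ d → Fin d → 𝔸ˣ} (hV₀ : ∀ x κ, V₀ x κ ∈ U1 𝔸)
    (A : SiteZ d → Fin d → 𝔸) {a α : ℝ} (ha : 0 ≤ a) (hA : ∀ x κ, ‖A x κ‖ ≤ a) (hac : a ≤ c3 d L)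
    (q : SiteZ d) (κ : Fin d) (hα1 : α ≤ 1 / 64)
    (hreg : ∀ i : IdxZ d L, ‖((WZ L V₀ q κ i : 𝔸ˣ) : 𝔸) - 1‖ ≤ α) :
    ‖CcovZ L V₀ A q κ‖ ≤ 131072 * ((d : ℝ) + 1) ^ 2 * (L : ℝ) ^ 2 * a ^ 2 := by
  refine (norm_CcovZ_le hL hV₀ A ha hA hac q κ hα1 hreg).trans (le_of_eq ?_)
  have hL0 : (0 : ℝ) < L := by exact_mod_cast hL
  have hpos : (0 : ℝ) < 128 * ((d : ℝ) + 1) * L := by positivity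
  rw [c3]
  field_simp
  ring

/-- **(123) in plaquette currency, for the record**: `V₀` unit-bounded with `pdev V₀ < β ≤ 1∕(1024(d+1)(d+4)L²)`, `L = 2s+1`, `sup_b|A_b| ≤ a ≤ c₃(d,L)` ⇒ `‖C(V₀, A, c)‖ ≤ 131072(d+1)²L²·a²`
at EVERY `L`-bond. [cite: Balaban1985Averaging, Proposition 3 (123) p.36, (109) p.34; Balaban1987RG1, (0.4) p.253] -/
theorem norm_CcovZ_le_of_pdev {s : ℕ} (hLs : L = 2 * s + 1) {V₀ : SiteZ d → Fin d → 𝔸ˣ} (hV₀ : ∀ x κ, V₀ x κ ∈ U1 𝔸)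
    {β : ℝ} (hβ0 : 0 ≤ β) (hβ : pdev V₀ < β) (hβmax : β ≤ 1 / (1024 * ((d : ℝ) + 1) * ((d : ℝ) + 4) * (L : ℝ) ^ 2))
    (A : SiteZ d → Fin d → 𝔸) {a : ℝ} (ha : 0 ≤ a) (hA : ∀ x κ, ‖A x κ‖ ≤ a) (hac : a ≤ c3 d L)
    (q : SiteZ d) (κ : Fin d) :
    ‖CcovZ L V₀ A q κ‖ ≤ 131072 * ((d : ℝ) + 1) ^ 2 * (L : ℝ) ^ 2 * a ^ 2 := by
  have hL1 : 1 ≤ L := by omega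
  obtain ⟨hreg, hα1⟩ := blockLoopsZ_of_pdev L hLs hV₀ hβ0 hβ hβmax q κ
  exact norm_CcovZ_le_explicit hL1 hV₀ A ha hA hac q κ hα1 hreg

/-! ## §4 The remainder binder of `B7Prop4GeneralLevelsRec.prop4_generalZ_of_prop3` supplied; additivity of «LQ» -/

/-- **the binder `h3rem` SUPPLIED for the record** (`βmax := 1∕(1024(d+1)(d+4)L²)`, `c₃ := c₃(d,L)`, `C₁ := 131072(d+1)²`): for every background `V₀` in a subgroup `G ≤ U1` with
`pdev V₀ < β ≤ βmax`, every field with `sup_b‖A_b‖ ≤ a ≤ c₃` and every `L`-bond: `‖Q(V₀, A, c) − L(Q(V₀)A)_c‖ ≤ C₁L²a²` — (123). [cite: Balaban1985Averaging, Proposition 3 (123) p.36] -/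
theorem h3remZ_of_pdev {s : ℕ} (hLs : L = 2 * s + 1) {G : Subgroup 𝔸ˣ} (hG : G ≤ U1 𝔸) :
    ∀ (V₀ : SiteZ d → Fin d → 𝔸ˣ) (β : ℝ), (∀ x κ, V₀ x κ ∈ G) → 0 ≤ β → pdev V₀ < β →
      β ≤ 1 / (1024 * ((d : ℝ) + 1) * ((d : ℝ) + 4) * (L : ℝ) ^ 2) →
      ∀ (A : SiteZ d → Fin d → 𝔸) (a : ℝ), 0 ≤ a → a ≤ c3 d L → (∀ x κ, ‖A x κ‖ ≤ a) →
      ∀ q κ, ‖QcovZ L V₀ A q κ - linQcovZ L V₀ A q κ‖ ≤ 131072 * ((d : ℝ) + 1) ^ 2 * (L : ℝ) ^ 2 * a ^ 2 :=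
  fun _V₀ _β hVG hβ0 hβ hβmax A _a ha hac hA q κ =>
    norm_CcovZ_le_of_pdev L hLs (fun x κ' => hG (hVG x κ')) hβ0 hβ hβmax A ha hA hac q κ

/-- **«L(Q(V₀)A)_c» is additive for the record** whenever the (0.4) loops at `c` are within `1` of the unit (`linQcovZ_add` ∕ `linQcovZ_smul`): `LQ(A − A′) = LQ A − LQ A′`.
[cite: Balaban1985Averaging, Proposition 3 (122) p.36] -/
theorem linQcovZ_sub_of_loops (L : ℕ) (V₀ : SiteZ d → Fin d → 𝔸ˣ) (A A' : SiteZ d → Fin d → 𝔸) (q : SiteZ d) (κ : Fin d)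
    (hW : ∀ i : IdxZ d L, ‖((WZ L V₀ q κ i : 𝔸ˣ) : 𝔸) - 1‖ < 1) :
    linQcovZ L V₀ (A - A') q κ = linQcovZ L V₀ A q κ - linQcovZ L V₀ A' q κ := by
  rw [sub_eq_add_neg, linQcovZ_add L V₀ A (-A') q κ hW, ← neg_one_smul ℂ A', linQcovZ_smul L V₀ (-1) A' q κ hW,
    neg_one_smul, ← sub_eq_add_neg]

/-! ## §5 Proposition 4 (130)∕(131) at a general regular background, k-uniform, for the record — UNCONDITIONAL -/

/-- «α₀ ≦ c₃» in plaquette currency: `4α₀ ≤ c₂′(d,L)` puts `2α₀` below `βmax = 1∕(1024(d+1)(d+4)L²)` (private helper, as in the engine). [cite: Balaban1985Averaging, p.37 (after (127))] -/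
private theorem two_mul_le_betaMax {L : ℕ} {α₀ : ℝ} (hα4 : 4 * α₀ ≤ c2' d L) :
    2 * α₀ ≤ 1 / (1024 * ((d : ℝ) + 1) * ((d : ℝ) + 4) * (L : ℝ) ^ 2) := by
  have h : 1 / (1024 * ((d : ℝ) + 1) * ((d : ℝ) + 4) * (L : ℝ) ^ 2) = c2' d L / 2 := by
    rw [c2', div_div]; congr 1; ring
  rw [h]; linarith

omit [NormedAlgebra ℂ 𝔸] [CompleteSpace 𝔸] [NormOneClass 𝔸] [NormedRing 𝔸] in
/-- `βmax = 1∕(1024(d+1)(d+4)L²) ≤ 1∕(2d(d+2)L²)`, the threshold of (126) for `Q̂` (`d ≥ 1`, `L ≥ 1`; private arithmetic). [cite: Balaban1985Averaging, (126) p.36 (bookkeeping)] -/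
private theorem betaMax_le (hd : 1 ≤ d) {L : ℕ} (hL : 1 ≤ L) :
    1 / (1024 * ((d : ℝ) + 1) * ((d : ℝ) + 4) * (L : ℝ) ^ 2) ≤ 1 / (2 * (d : ℝ) * (d + 2) * (L : ℝ) ^ 2) := by
  have hd1 : (1 : ℝ) ≤ d := by exact_mod_cast hd
  have hL1 : (1 : ℝ) ≤ L := by exact_mod_cast hL
  have hpos : 0 < 2 * (d : ℝ) * (d + 2) * (L : ℝ) ^ 2 := by positivity
  have hle : 2 * (d : ℝ) * (d + 2) * (L : ℝ) ^ 2 ≤ 1024 * ((d : ℝ) + 1) * ((d : ℝ) + 4) * (L : ℝ) ^ 2 := by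
    have hL2 : 0 ≤ (L : ℝ) ^ 2 := by positivity
    nlinarith [mul_nonneg (by positivity : (0 : ℝ) ≤ d) hL2, mul_nonneg (mul_nonneg (by positivity : (0 : ℝ) ≤ d) (by positivity : (0:ℝ) ≤ d)) hL2]
  exact one_div_le_one_div_of_le hpos hle

/-- «for α₁ ≦ ½c₃ we can apply Proposition 3 … calculated at Q(U₀, ηA)» (p. 37), record constant: `KZ·L^kb ≤ c₃` gives `KZ·L^jb ≤ c₃` at every earlier level. [cite: Balaban1985Averaging, p.37 (after (129))] -/
theorem levels_le_c3Z {L : ℕ} (hL : 1 ≤ L) {k : ℕ} {b c K : ℝ} (hb : 0 ≤ b) (hK : 0 ≤ K)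
    (hc₃ : K * ((L : ℝ) ^ k * b) ≤ c) : ∀ j < k, K * ((L : ℝ) ^ j * b) ≤ c := by
  intro j hj
  have hL1 : (1 : ℝ) ≤ L := by exact_mod_cast hL
  have h1 : (L : ℝ) ^ j * b ≤ (L : ℝ) ^ k * b := mul_le_mul_of_nonneg_right (pow_le_pow_right₀ hL1 hj.le) hb
  exact (mul_le_mul_of_nonneg_left h1 hK).trans hc₃

/-- ★★★ **[3] PROPOSITION 4, THE BOUNDS (128)∕(130)∕(131) AT EVERY LEVEL `j ≤ k`, AT A GENERAL REGULAR BACKGROUND, k-UNIFORM — FOR THE RECORD's AVERAGING STRUCTURE, KERNEL,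
UNCONDITIONAL.**  Data: odd `L = 2s+1 ≥ 3`, `d ≥ 1`; `U₀` with values in a subgroup `G` closed under the record average (`B7Prop2Rec.AvgClosedZ`), `pdev U₀ < α₀L^{−2k}`, `C₀α₀ ≤ 1∕3`
(`C₀ = C0Z d`), `4α₀ ≤ c₂′(d,L)`; the field `B` with `sup‖B‖ ≤ b`; smallness `e^{4cZα₀}(1 + 2C₁KZ²·L^kb) ≤ 2` (`cZ = 16(d+1)(d+2)²`, `C₁ = 131072(d+1)²`, `KZ = 2(1+4dL)`) and `KZ·L^kb ≤ c₃(d,L)`.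
CONCLUSION, for every `j ≤ k` and every `L^j`-bond: (126)_rec `‖L^jηQ_j(U₀)B‖ ≤ (1+2gZ)e^{4cZα₀}·L^jb`; (130)_rec `‖Q_j(U₀,ηB) − L^jηQ_j(U₀)B‖ ≤ (1+2gZ)·2C₁KZ²·e^{4cZα₀}·(L^jb)²`;
(131)_rec `‖Q_j(U₀,ηB)‖ ≤ KZ·L^jb` — for the record's composites `logCovIterZ`∕`linCovIterZ` (127).  Print's (130)∕(131) with constants in `d, L` only, UNIFORM IN `k`: the carried coarse gauge
letters accumulate additively (`B7Prop4GaugeInductionRec`). [cite: Balaban1985Averaging, Proposition 4 (128)–(131) pp.37–38, (127) p.37; Balaban1987RG1, (0.4) p.253] -/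
theorem prop4_generalZ {s : ℕ} (hLs : L = 2 * s + 1) (hs : 1 ≤ s) (hd : 1 ≤ d) {G : Subgroup 𝔸ˣ} (hG : AvgClosedZ d L G) (k : ℕ)
    (U₀ : SiteZ d → Fin d → 𝔸ˣ) (hU₀ : ∀ x κ, U₀ x κ ∈ G) {α₀ : ℝ} (hα : 0 < α₀)
    (hα3 : C0Z d * α₀ ≤ 1 / 3) (hα4 : 4 * α₀ ≤ c2' d L) (h52 : pdev U₀ < α₀ * (((L : ℝ) ^ k)⁻¹) ^ 2)
    (B : SiteZ d → Fin d → 𝔸) {b : ℝ} (hb : 0 ≤ b) (hB : ∀ x κ, ‖B x κ‖ ≤ b)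
    (hsmall : Real.exp (4 * cZ d * α₀) * (1 + 2 * (131072 * ((d : ℝ) + 1) ^ 2) * (KZ d L) ^ 2 * ((L : ℝ) ^ k * b)) ≤ 2)
    (hc₃ : KZ d L * ((L : ℝ) ^ k * b) ≤ c3 d L) :
    ∀ j ≤ k,
      (∀ z κ, ‖linCovIterZ L U₀ B j z κ‖ ≤ (1 + 2 * gZ d L) * Real.exp (4 * cZ d * α₀) * ((L : ℝ) ^ j * b)) ∧
      (∀ z κ, ‖logCovIterZ L U₀ B j z κ - linCovIterZ L U₀ B j z κ‖
        ≤ (1 + 2 * gZ d L) * (2 * (131072 * ((d : ℝ) + 1) ^ 2) * (KZ d L) ^ 2) * Real.exp (4 * cZ d * α₀) * ((L : ℝ) ^ j * b) ^ 2) ∧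
      (∀ z κ, ‖logCovIterZ L U₀ B j z κ‖ ≤ KZ d L * ((L : ℝ) ^ j * b)) := by
  have hL1 : 1 ≤ L := by omega
  have hα2 : 2 * α₀ ≤ c2' d L := by linarith
  have hK0 : 0 ≤ KZ d L := by unfold KZ; have := gZ_nonneg d L; positivity
  exact prop4_generalZ_of_prop3 L hLs hs hG (C₁ := 131072 * ((d : ℝ) + 1) ^ 2) (c₃ := c3 d L)
    (βmax := 1 / (1024 * ((d : ℝ) + 1) * ((d : ℝ) + 4) * (L : ℝ) ^ 2)) (by positivity) (betaMax_le hd hL1)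
    (h3remZ_of_pdev L hLs hG.le_U1) k U₀ hU₀ hα hα3 hα2 h52 (two_mul_le_betaMax hα4) B hb hB hsmall
    (levels_le_c3Z hL1 hb hK0 hc₃)

/-! ## §6 «(1∕i) log U̿₁ᵏ … is a composition of the functions (127)» and (161), for the record -/

/-- per-level data for the record: every `Ū₀ʲ`, `j ≤ k`, is unit-bounded with plaquette deviation `< 2α₀(L^j∕L^k)² ≤ βmax`. [cite: Balaban1985Averaging, p.37 (after (127)), Prop. 2 (54) p.26] -/
theorem level_dataZ (hL : 2 ≤ L) {G : Subgroup 𝔸ˣ} (hG : AvgClosedZ d L G) (k : ℕ)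
    (U₀ : SiteZ d → Fin d → 𝔸ˣ) (hU₀ : ∀ x κ, U₀ x κ ∈ G) {α₀ : ℝ} (hα : 0 < α₀)
    (hα3 : C0Z d * α₀ ≤ 1 / 3) (hα4 : 4 * α₀ ≤ c2' d L) (h52 : pdev U₀ < α₀ * (((L : ℝ) ^ k)⁻¹) ^ 2) :
    ∀ j ≤ k, (∀ x κ, avgIterZ L U₀ j x κ ∈ U1 𝔸) ∧ 0 ≤ 2 * (α₀ * ((L : ℝ) ^ j * ((L : ℝ) ^ k)⁻¹) ^ 2) ∧
      pdev (avgIterZ L U₀ j) < 2 * (α₀ * ((L : ℝ) ^ j * ((L : ℝ) ^ k)⁻¹) ^ 2) ∧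
      2 * (α₀ * ((L : ℝ) ^ j * ((L : ℝ) ^ k)⁻¹) ^ 2) ≤ 1 / (1024 * ((d : ℝ) + 1) * ((d : ℝ) + 4) * (L : ℝ) ^ 2) := by
  intro j hj
  have hα2 : 2 * α₀ ≤ c2' d L := by linarith
  have hreg := level_regularityZ L hL hG k U₀ hU₀ hα hα3 hα2 h52 j hj
  have hL1 : (1 : ℝ) ≤ L := by exact_mod_cast le_trans (by norm_num) hL
  have hLk : (0 : ℝ) < (L : ℝ) ^ k := by positivity
  have hratio : (L : ℝ) ^ j * ((L : ℝ) ^ k)⁻¹ ≤ 1 := by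
    rw [mul_inv_le_iff₀ hLk, one_mul]; exact pow_le_pow_right₀ hL1 hj
  have h1 : ((L : ℝ) ^ j * ((L : ℝ) ^ k)⁻¹) ^ 2 ≤ 1 := by
    rw [← one_pow 2]; exact pow_le_pow_left₀ (by positivity) hratio 2
  refine ⟨fun x κ => hG.le_U1 (hreg.2 x κ), by positivity, hreg.1, ?_⟩
  have := two_mul_le_betaMax (d := d) (L := L) hα4
  nlinarith [mul_le_mul_of_nonneg_left h1 hα.le]

/-- ★ **`U̿₁ʲ = e^{Q_j(U₀, ηB)}` BONDWISE FOR EVERY `j ≤ k`, FOR THE RECORD** — (127) «(1∕i) log U̿₁ᵏ … is a composition of the functions Q(U₀, ·), Q(Ū₀, ·), …»: under the hypotheses of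
`prop4_generalZ` the iterate (90)∕(91) `dbavgCovIterZ L U₀ (e^{B}) j` equals `e^{logCovIterZ L U₀ B j}` (at each level the argument has sup norm `≤ KZ·L^jb ≤ c₃` by (131)_rec and the level
background is regular, so `‖V̿₁ − 1‖ ≤ 4∕5 < 1` by `logDomainCovZ` and `e^{log V̿₁} = V̿₁`). [cite: Balaban1985Averaging, (127) p.37, (90)–(91) p.31, (21)–(22) p.21; Balaban1987RG1, (0.4) p.253] -/
theorem dbavgCovIterZ_eq_expCfg_logCovIterZ {s : ℕ} (hLs : L = 2 * s + 1) (hs : 1 ≤ s) (hd : 1 ≤ d) {G : Subgroup 𝔸ˣ}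
    (hG : AvgClosedZ d L G) (k : ℕ) (U₀ : SiteZ d → Fin d → 𝔸ˣ) (hU₀ : ∀ x κ, U₀ x κ ∈ G) {α₀ : ℝ} (hα : 0 < α₀)
    (hα3 : C0Z d * α₀ ≤ 1 / 3) (hα4 : 4 * α₀ ≤ c2' d L) (h52 : pdev U₀ < α₀ * (((L : ℝ) ^ k)⁻¹) ^ 2)
    (B : SiteZ d → Fin d → 𝔸) {b : ℝ} (hb : 0 ≤ b) (hB : ∀ x κ, ‖B x κ‖ ≤ b)
    (hsmall : Real.exp (4 * cZ d * α₀) * (1 + 2 * (131072 * ((d : ℝ) + 1) ^ 2) * (KZ d L) ^ 2 * ((L : ℝ) ^ k * b)) ≤ 2)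
    (hc₃ : KZ d L * ((L : ℝ) ^ k * b) ≤ c3 d L) :
    ∀ j ≤ k, dbavgCovIterZ L U₀ (expCfg B) j = expCfg (logCovIterZ L U₀ B j) := by
  have hL2 : 2 ≤ L := by omega
  have hL1 : 1 ≤ L := by omega
  have hK0 : 0 ≤ KZ d L := by unfold KZ; have := gZ_nonneg d L; positivity
  have hbd := prop4_generalZ L hLs hs hd hG k U₀ hU₀ hα hα3 hα4 h52 B hb hB hsmall hc₃
  have hlev := level_dataZ L hL2 hG k U₀ hU₀ hα hα3 hα4 h52
  have hc₃' := levels_le_c3Z hL1 hb hK0 hc₃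
  intro j
  induction j with
  | zero => intro _; rfl
  | succ j ih =>
    intro hjk
    have hj : j < k := Nat.lt_of_succ_le hjk
    obtain ⟨hV₀, hβ0, hβ, hβmax⟩ := hlev j hj.le
    have hA : ∀ x κ', ‖logCovIterZ L U₀ B j x κ'‖ ≤ KZ d L * ((L : ℝ) ^ j * b) := (hbd j hj.le).2.2
    have hac : KZ d L * ((L : ℝ) ^ j * b) ≤ c3 d L := hc₃' j hj
    funext z κ
    obtain ⟨hreg, hα1⟩ := blockLoopsZ_of_pdev L hLs hV₀ hβ0 hβ hβmax ((L : ℤ) • z) κ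
    have hdom := (logDomainCovZ hL1 hV₀ (logCovIterZ L U₀ B j) (by positivity) hA le_rfl (by positivity)
      (theta_le_of_le_c3 hL1 hac) ((L : ℤ) • z) κ hα1 hreg).2.2.2
    have hlt : ‖((dbavgCovZ L (avgIterZ L U₀ j) (expCfg (logCovIterZ L U₀ B j)) ((L : ℤ) • z) κ : 𝔸ˣ) : 𝔸) - 1‖ < 1 :=
      hdom.trans_lt (by norm_num)
    rw [dbavgCovIterZ_succ_apply, ih hj.le]
    show _ = expUnit (mlog ((dbavgCovZ L (avgIterZ L U₀ j) (expCfg (logCovIterZ L U₀ B j)) ((L : ℤ) • z) κ : 𝔸ˣ) : 𝔸))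
    rw [B7Prop4Flat.expUnit_mlog hlt]

/-- **(161) AT A GENERAL REGULAR BACKGROUND FOR THE RECORD**: «|(1∕i) log U̿′^j| = |Q_j(U₀, ηA′)| < 2α₁L^jη» with the record's constant `KZ` for print's `2` — under the hypotheses of
`prop4_generalZ`, for `1 ≤ j ≤ k` and every `L^j`-bond: the logarithm of the `j`-fold double-bar average (91) IS the composite `Q_j(U₀, ηB)` (127) and `‖(1∕i) log U̿′^j‖ ≤ KZ·L^jb`.
[cite: Balaban1985Averaging, (161) p.42, (131) p.38, (127) p.37; Balaban1987RG1, (0.4) p.253] -/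
theorem norm_mlog_dbavgCovIterZ_le {s : ℕ} (hLs : L = 2 * s + 1) (hs : 1 ≤ s) (hd : 1 ≤ d) {G : Subgroup 𝔸ˣ}
    (hG : AvgClosedZ d L G) (k : ℕ) (U₀ : SiteZ d → Fin d → 𝔸ˣ) (hU₀ : ∀ x κ, U₀ x κ ∈ G) {α₀ : ℝ} (hα : 0 < α₀)
    (hα3 : C0Z d * α₀ ≤ 1 / 3) (hα4 : 4 * α₀ ≤ c2' d L) (h52 : pdev U₀ < α₀ * (((L : ℝ) ^ k)⁻¹) ^ 2)
    (B : SiteZ d → Fin d → 𝔸) {b : ℝ} (hb : 0 ≤ b) (hB : ∀ x κ, ‖B x κ‖ ≤ b)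
    (hsmall : Real.exp (4 * cZ d * α₀) * (1 + 2 * (131072 * ((d : ℝ) + 1) ^ 2) * (KZ d L) ^ 2 * ((L : ℝ) ^ k * b)) ≤ 2)
    (hc₃ : KZ d L * ((L : ℝ) ^ k * b) ≤ c3 d L) {j : ℕ} (hjk : j + 1 ≤ k) (z : SiteZ d) (κ : Fin d) :
    mlog ((dbavgCovIterZ L U₀ (expCfg B) (j + 1) z κ : 𝔸ˣ) : 𝔸) = logCovIterZ L U₀ B (j + 1) z κ ∧
      ‖mlog ((dbavgCovIterZ L U₀ (expCfg B) (j + 1) z κ : 𝔸ˣ) : 𝔸)‖ ≤ KZ d L * ((L : ℝ) ^ (j + 1) * b) := by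
  have hval : mlog ((dbavgCovIterZ L U₀ (expCfg B) (j + 1) z κ : 𝔸ˣ) : 𝔸) = logCovIterZ L U₀ B (j + 1) z κ := by
    rw [dbavgCovIterZ_succ_apply, dbavgCovIterZ_eq_expCfg_logCovIterZ L hLs hs hd hG k U₀ hU₀ hα hα3 hα4 h52 B hb hB hsmall hc₃ j
      (Nat.le_of_succ_le hjk), logCovIterZ_succ]
    rfl
  exact ⟨hval, hval ▸ (prop4_generalZ L hLs hs hd hG k U₀ hU₀ hα hα3 hα4 h52 B hb hB hsmall hc₃ (j + 1) hjk).2.2 z κ⟩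

end Literature.MathematicalPhysics.QuantumFieldTheory.Balaban1983to89.B7Eq123GeneralRec
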